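import Summits.NavierStokesRegularity.NavierStokesRegularity.Theses.FlatSwirlGauge
import Literature.Analysis.FluidPDE.FlatSwirlGaugeChart

/-!
# `FlatGaugeAtSingularity` restated BY NAME over the landed gauge vocabulary

Crux `FlatGaugeAtSingularity` (FG, item `stmt-NavierStokesRegularity-1252`, route `FlatSwirlGauge` of
`NavierStokesRegularity`) carries the route's v0 gauge block INLINE. The Literature files
`FlatSwirlGauge.lean` (`hasFlatSwirlGauge_iff`, `Iff.rfl`) and `FlatSwirlGaugeChart.lean`
(`hasFlatSwirlGauge_iff_chart_and_defect`, `hasFlatSwirlGauge_iff_intrinsic`) restate that block POINTWISE in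
`(ν, u, T, x₀)`. This file lifts the three restatements to the crux itself, by name, so that a planner's
restatement of the item over the notion (route header: "a later restatement over it changes no meaning")
is a kernel-checked equivalence:

* `flatGaugeAtSingularity_iff_hasFlatSwirlGauge` — FG ⟺ "every singular point `(T, x₀)` of every Leray–Hopf
  classical solution from a decaying datum admits a flat swirl gauge" (`HasFlatSwirlGauge ν u T x₀`);
* `flatGaugeAtSingularity_iff_chart_and_defect` — FG ⟺ the same with the gauge replaced by a kinematic
  vortex chart with drift-size transport defect (exactly the data of the registered line's two stubs K and D);
* `flatGaugeAtSingularity_iff_intrinsic` — FG ⟺ the same with a momentum `α` ALONE: a bounded `C²` first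
  integral of `curl u` on `Q_ρ(T, x₀)` whose two scale-invariant ratios `‖∇α‖/‖curl u‖` and
  `ν‖∇α‖/|∂ₜα + (u·∇)α − νΔα|` are small only on an axis-like thin set (no auxiliary drift `b`, depth `d`).

No new mathematics: three `forall`-congruences over landed `Iff`s. Deliberately NOT here: any existence
statement (the crux is open; `Theorems/FlatGaugeAtSingularity/Negative/*` record what a proof must avoid).
-/

-- the problem namespace `Summit.NavierStokesRegularity.NavierStokesRegularity` repeats the summit name by design (D-0017)
set_option linter.dupNamespace false

noncomputable section

open Set MeasureTheory Metric Function
open scoped RealInnerProductSpace ENNReal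
open Literature.Analysis.FluidPDE
open Summit.NavierStokesRegularity.NavierStokesRegularity.Theses.FlatSwirlGauge

namespace Summit.NavierStokesRegularity.NavierStokesRegularity.Theorems

/-- **FG over the notion.** `FlatGaugeAtSingularity` is, letter for letter, the statement that every
singular point `(T, x₀)` (no bounded backward cylinder) of every Leray–Hopf classical solution on `[0, T)`
from a rapidly decaying datum admits a flat swirl gauge `HasFlatSwirlGauge ν u T x₀`
(`hasFlatSwirlGauge_iff` is `Iff.rfl`, so this is `Iff.rfl` too). -/
theorem flatGaugeAtSingularity_iff_hasFlatSwirlGauge :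
    FlatGaugeAtSingularity ↔
      ∀ (ν T : ℝ), 0 < ν → 0 < T →
        ∀ (u : ℝ → EuclideanSpace ℝ (Fin 3) → EuclideanSpace ℝ (Fin 3))
          (p : ℝ → EuclideanSpace ℝ (Fin 3) → ℝ),
          IsClassicalNSSolutionOn (Set.Ico 0 T) ν 0 u p → IsLerayHopfOn T ν 0 (u 0) u →
          HasRapidSpatialDecay (u 0) →
          ∀ x₀ : EuclideanSpace ℝ (Fin 3),
            ¬ (∃ r : ℝ, 0 < r ∧ ∃ K : ℝ, ∀ t ∈ Set.Ioo (T - r ^ 2) T, 0 ≤ t →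
                ∀ x ∈ Metric.ball x₀ r, ‖u t x‖ ≤ K) →
            HasFlatSwirlGauge ν u T x₀ :=
  Iff.rfl

/-- **FG as "chart with drift-size defect at every singular point".** `FlatGaugeAtSingularity` holds iff
at every singular point of every solution of the class there are `ρ, C₀, M, C₁ ≥ 0`, a momentum `α` and a
depth `d` forming a kinematic vortex chart `IsVortexChartOn u T x₀ ρ C₀ M α d` whose transport defect is of
drift size, `HasDriftSizeDefectOn ν u T x₀ ρ C₁ α d` — the conclusions of the registered line's stubs K
and D taken jointly (lossless seam `hasFlatSwirlGauge_iff_chart_and_defect`, which needs `0 < ν`, available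
under the crux's own hypothesis). -/
theorem flatGaugeAtSingularity_iff_chart_and_defect :
    FlatGaugeAtSingularity ↔
      ∀ (ν T : ℝ), 0 < ν → 0 < T →
        ∀ (u : ℝ → EuclideanSpace ℝ (Fin 3) → EuclideanSpace ℝ (Fin 3))
          (p : ℝ → EuclideanSpace ℝ (Fin 3) → ℝ),
          IsClassicalNSSolutionOn (Set.Ico 0 T) ν 0 u p → IsLerayHopfOn T ν 0 (u 0) u →
          HasRapidSpatialDecay (u 0) →
          ∀ x₀ : EuclideanSpace ℝ (Fin 3),
            ¬ (∃ r : ℝ, 0 < r ∧ ∃ K : ℝ, ∀ t ∈ Set.Ioo (T - r ^ 2) T, 0 ≤ t →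
                ∀ x ∈ Metric.ball x₀ r, ‖u t x‖ ≤ K) →
            ∃ (ρ C₀ M C₁ : ℝ) (α : ℝ → EuclideanSpace ℝ (Fin 3) → ℝ)
              (d : ℝ → EuclideanSpace ℝ (Fin 3) → ℝ),
              IsVortexChartOn u T x₀ ρ C₀ M α d ∧ 0 ≤ C₁ ∧ HasDriftSizeDefectOn ν u T x₀ ρ C₁ α d := by
  refine forall₂_congr fun ν T => forall_congr' fun hν => forall_congr' fun _ => ?_
  refine forall₂_congr fun u p => forall₃_congr fun _ _ _ => forall₂_congr fun x₀ _ => ?_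
  exact hasFlatSwirlGauge_iff_chart_and_defect hν

/-- **The intrinsic form of FG** (a statement about ONE scalar). `FlatGaugeAtSingularity` holds iff at
every singular point `(T, x₀)` of every solution of the class there are `ρ > 0` (`ρ² < T`), `C₀ ≥ 0`, `M`
and a momentum `α` alone, `C²` on `Q_ρ(T, x₀) = (T − ρ², T) × B_ρ(x₀)`, with `|α| ≤ M`, `⟪curl u, ∇α⟫ = 0`
(a first integral of the vorticity), and, for every admissible `t` and `δ ∈ (0, ρ)`,
`vol(({C₀‖∇α‖ < δ‖curl u‖} ∪ {νC₀‖∇α‖ < δ |∂ₜα + (u·∇)α − νΔα|}) ∩ B_ρ(x₀)) ≤ C₀ δ² ρ`: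
the auxiliary drift `b` and depth `d` of the inline rendering carry no information
(`hasFlatSwirlGauge_iff_intrinsic`: `b := driftOf`, `d := gaugeDepth`). This is the restatement target
named by the line leads c1/c2 of the crux (Cruxes/FlatGaugeAtSingularity/NOTES.md). -/
theorem flatGaugeAtSingularity_iff_intrinsic :
    FlatGaugeAtSingularity ↔
      ∀ (ν T : ℝ), 0 < ν → 0 < T →
        ∀ (u : ℝ → EuclideanSpace ℝ (Fin 3) → EuclideanSpace ℝ (Fin 3))
          (p : ℝ → EuclideanSpace ℝ (Fin 3) → ℝ),
          IsClassicalNSSolutionOn (Set.Ico 0 T) ν 0 u p → IsLerayHopfOn T ν 0 (u 0) u →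
          HasRapidSpatialDecay (u 0) →
          ∀ x₀ : EuclideanSpace ℝ (Fin 3),
            ¬ (∃ r : ℝ, 0 < r ∧ ∃ K : ℝ, ∀ t ∈ Set.Ioo (T - r ^ 2) T, 0 ≤ t →
                ∀ x ∈ Metric.ball x₀ r, ‖u t x‖ ≤ K) →
            ∃ (ρ C₀ M : ℝ) (α : ℝ → EuclideanSpace ℝ (Fin 3) → ℝ), 0 ≤ C₀ ∧ 0 < ρ ∧ ρ ^ 2 < T ∧
              ContDiffOn ℝ 2 (uncurry α) (Ioo (T - ρ ^ 2) T ×ˢ ball x₀ ρ) ∧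
              (∀ t ∈ Ioo (T - ρ ^ 2) T, ∀ x ∈ ball x₀ ρ,
                |α t x| ≤ M ∧ ⟪curl (u t) x, gradient (α t) x⟫ = 0) ∧
              ∀ t ∈ Ioo (T - ρ ^ 2) T, ∀ δ ∈ Ioo 0 ρ,
                volume (({x | C₀ * ‖gradient (α t) x‖ < δ * ‖curl (u t) x‖} ∪
                    {x | ν * C₀ * ‖gradient (α t) x‖ < δ * |transportDefect ν u α t x|}) ∩ ball x₀ ρ) ≤
                  ENNReal.ofReal (C₀ * δ ^ 2 * ρ) := by
  refine forall₂_congr fun ν T => forall_congr' fun hν => forall_congr' fun _ => ?_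
  refine forall₂_congr fun u p => forall₃_congr fun _ _ _ => forall₂_congr fun x₀ _ => ?_
  exact hasFlatSwirlGauge_iff_intrinsic hν

end Summit.NavierStokesRegularity.NavierStokesRegularity.Theorems

end
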